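import Literature.Probability.LatticeModels.CycleConvexityInfrared
import Literature.Probability.LatticeModels.TorusNegTypeBochner
import Literature.Analysis.Matrix.SchoenbergKernelsProofs
import HarnessLib

/-!
# The discrete Pólya criterion on the cycle `ℤ/Lℤ` and infinite divisibility of log-convex kernels

Topic `Literature/Probability/LatticeModels`; the lower-bound companion of
`CycleConvexityInfrared.lean`. There a real function `g` on the cycle `ℤ/Lℤ` with nonnegative second
differences away from the origin, `Δ²g(n) ≥ 0` for `n ≠ 0`, was shown to obey the infrared-type UPPER
bound `(1 − cos p) Re ĝ(p) ≤ −Δ²g(0)`. The same summation by parts also bounds `Re ĝ(p)` from BELOW: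

`2(1 − cos p) · Re Σ_n e^{−ipn} g(n) = −Σ_n cos(pn) Δ²g(n) = −Δ²g(0) − Σ_{n≠0} cos(pn) Δ²g(n)
  ≥ −Δ²g(0) − Σ_{n≠0} Δ²g(n) = −Σ_n Δ²g(n) = 0,`

so every NONZERO Fourier mode of a convex-off-the-origin function is nonnegative — the finite-cycle
form of Pólya's criterion (an even function, convex on the complement of the origin, is positive
definite up to its mean; Pólya 1949, Thm. 1, for the real line). Combined with Bochner's theorem on the
finite torus (`isNegDefKernel_neg_sub_iff_torusFourier_re_nonneg`) and Schoenberg's theorem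
(`IsNegDefKernel.isPosDefKernel_exp_neg`, Berg–Christensen–Ressel 1984, Ch. 3 Thm. 2.2) this gives the
classical sufficient condition for INFINITE DIVISIBILITY of a translation-invariant kernel on the
cycle: if `k > 0` is even and log-convex away from the origin, `k(n)² ≤ k(n−1) k(n+1)` for `n ≠ 0`
(at the antipode this reads `k(L/2) ≤ k(L/2 ± 1)`), then `−log k(x − y)` is negative definite and every
Hadamard power `k(x − y)^t`, `t ≥ 0`, is positive semidefinite (Horn 1969, Thm. 1.6 / Cor. 1.7:
`k` infinitely divisible iff `−log k` conditionally negative definite).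

* `re_stdAddChar_lt_one` — `Re ψ(m) < 1` for `m ≠ 0` (`ψ = ZMod.stdAddChar`);
* `re_sum_stdAddChar_mul_nonneg_of_cycleLaplacian_nonneg` — the discrete Pólya criterion
  `0 ≤ Re Σ_n ψ(−mn) g(n)` for `m ≠ 0`, and its cosine-coefficient form
  `sum_mul_re_stdAddChar_nonneg_of_cycleLaplacian_nonneg` (`0 ≤ Σ_n g(n) Re ψ(mn)`);
* `sum_mul_re_torusChar_nonneg_of_cycleLaplacian_nonneg` — the same in the vocabulary of
  `TorusFourierProofs` (`TorusSite 1 L`, characters `torusChar`);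
* `cycleLaplacian_log_nonneg_of_sq_le` — log-convexity `k(n)² ≤ k(n−1)k(n+1)` is `Δ² log k (n) ≥ 0`;
* `isNegDefKernel_negLog_of_logConvex_off_zero` — `−log k(x − y)` is negative definite;
* `isPosDefKernel_rpow_of_logConvex_off_zero`, `posSemidef_rpow_of_logConvex_off_zero` — every
  Hadamard power `k(x − y)^t`, `t ≥ 0`, is a positive definite kernel / a positive semidefinite
  `ZMod L × ZMod L` matrix (infinite divisibility).

Everything here is proved; no definitions, no named facts. [folklore]

## References

* G. Pólya, *Remarks on characteristic functions*, Proc. (First) Berkeley Symp. Math. Statist.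
  Probab. (1949) 115–123, Thm. 1 (`Polya1949`).
* C. Berg, J. P. R. Christensen, P. Ressel, *Harmonic Analysis on Semigroups*, GTM 100 (1984), Ch. 3
  Thm. 2.2 (PDF p. 75), Ch. 4 §3 (`BergChristensenRessel1984`).
* R. A. Horn, *The theory of infinitely divisible matrices and kernels*, Trans. Amer. Math. Soc. 136
  (1969) 269–286, Thm. 1.6, Cor. 1.7 (`Horn1969`).
* J. Fröhlich, B. Simon, T. Spencer, Comm. Math. Phys. 50 (1976) 79–95, Appendix; C. Borgs,
  E. Seiler, Comm. Math. Phys. 91 (1983) 329–380, Lemma III.8 (the summation by parts,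
  `BorgsSeiler1983`).
-/

noncomputable section

open Finset Complex
open scoped ComplexConjugate

namespace Literature.Probability.LatticeModels

open Literature.Analysis.Matrix

variable {L : ℕ} [NeZero L]

/-! ### The discrete Pólya criterion on `ℤ/Lℤ` -/

/-- A nontrivial character value has real part `< 1`: `Re ψ(m) < 1` for `m ≠ 0`
(`ψ = ZMod.stdAddChar` is injective and unimodular). [folklore] -/
theorem re_stdAddChar_lt_one {m : ZMod L} (hm : m ≠ 0) : (ZMod.stdAddChar m : ℂ).re < 1 := by
  have hnorm : ‖(ZMod.stdAddChar m : ℂ)‖ = 1 := by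
    rw [ZMod.stdAddChar_apply, Circle.norm_coe]
  have hle : (ZMod.stdAddChar m : ℂ).re ≤ 1 := (Complex.re_le_norm _).trans hnorm.le
  refine lt_of_le_of_ne hle fun h => hm ?_
  have hsq : Complex.normSq (ZMod.stdAddChar m : ℂ) = 1 := by
    rw [Complex.normSq_eq_norm_sq, hnorm, one_pow]
  rw [Complex.normSq_apply, h, one_mul] at hsq
  have him : (ZMod.stdAddChar m : ℂ).im = 0 := by
    have : (ZMod.stdAddChar m : ℂ).im * (ZMod.stdAddChar m : ℂ).im = 0 := by linarith
    exact mul_self_eq_zero.1 this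
  have hone : (ZMod.stdAddChar m : ℂ) = 1 := Complex.ext (by simp [h]) (by simp [him])
  exact ZMod.injective_stdAddChar (hone.trans (AddChar.map_zero_eq_one _).symm)

/-- **Discrete Pólya criterion on the cycle.** If `Δ²g(n) ≥ 0` for all `n ≠ 0` on `ℤ/Lℤ`, then
every nonzero Fourier mode of `g` has nonnegative real part:
`0 ≤ Re Σ_n ψ(−mn) g(n)` for `m ≠ 0` (`ψ = ZMod.stdAddChar`). Summation by parts
(`stdAddChar_symm_sub_two_mul_sum`) gives `(2 Re ψ(m) − 2) Re ĝ(m) = Σ_n Re ψ(−mn) Δ²g(n)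
≤ Δ²g(0) + Σ_{n≠0} Δ²g(n) = 0`, and `2 Re ψ(m) − 2 < 0`. [cite: Polya1949, Thm. 1] -/
theorem re_sum_stdAddChar_mul_nonneg_of_cycleLaplacian_nonneg (g : ZMod L → ℝ)
    (hconv : ∀ n : ZMod L, n ≠ 0 → 0 ≤ cycleLaplacian g n) {m : ZMod L} (hm : m ≠ 0) :
    0 ≤ (∑ n : ZMod L, (ZMod.stdAddChar (-(m * n)) : ℂ) * g n).re := by
  classical
  have hsbp := stdAddChar_symm_sub_two_mul_sum g m
  have hpre : ((ZMod.stdAddChar m : ℂ) + ZMod.stdAddChar (-m) - 2) =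
      ((2 * (ZMod.stdAddChar m : ℂ).re - 2 : ℝ) : ℂ) := by
    rw [stdAddChar_neg_eq_conj, Complex.add_conj]
    push_cast; ring
  rw [hpre] at hsbp
  have hre := congrArg Complex.re hsbp
  rw [Complex.re_ofReal_mul] at hre
  have hrhs : (∑ n : ZMod L, (ZMod.stdAddChar (-(m * n)) : ℂ) * (cycleLaplacian g n : ℝ)).re =
      ∑ n : ZMod L, (ZMod.stdAddChar (-(m * n)) : ℂ).re * cycleLaplacian g n := by
    rw [Complex.re_sum]
    refine sum_congr rfl fun n _ => ?_
    simp only [Complex.mul_re, Complex.ofReal_re, Complex.ofReal_im, mul_zero, sub_zero]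
  rw [hrhs] at hre
  -- `hre : (2 Re ψ m − 2) * S.re = Σ_n Re ψ(−mn) * Δ²g(n)`
  have hsplit : ∑ n : ZMod L, (ZMod.stdAddChar (-(m * n)) : ℂ).re * cycleLaplacian g n =
      cycleLaplacian g 0 +
        ∑ n ∈ univ.erase (0 : ZMod L), (ZMod.stdAddChar (-(m * n)) : ℂ).re * cycleLaplacian g n := by
    rw [← add_sum_erase _ _ (mem_univ (0 : ZMod L))]
    simp
  have hsum0 : ∑ n ∈ univ.erase (0 : ZMod L), cycleLaplacian g n = -cycleLaplacian g 0 := by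
    have h := sum_cycleLaplacian g
    rw [← add_sum_erase _ _ (mem_univ (0 : ZMod L))] at h
    linarith
  -- the modes `n ≠ 0`: `Re ψ(−mn) Δ²g(n) ≤ Δ²g(n)`
  have hbound : ∑ n ∈ univ.erase (0 : ZMod L), (ZMod.stdAddChar (-(m * n)) : ℂ).re * cycleLaplacian g n
      ≤ ∑ n ∈ univ.erase (0 : ZMod L), cycleLaplacian g n := by
    refine sum_le_sum fun n hn => ?_
    have hc := hconv n (ne_of_mem_erase hn)
    have ha := abs_re_stdAddChar_le_one (L := L) (-(m * n))
    have hup : (ZMod.stdAddChar (-(m * n)) : ℂ).re ≤ 1 := (le_abs_self _).trans ha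
    nlinarith
  have hprod : 0 ≤ (2 - 2 * (ZMod.stdAddChar m : ℂ).re) *
      (∑ n : ZMod L, (ZMod.stdAddChar (-(m * n)) : ℂ) * g n).re := by
    have : (2 - 2 * (ZMod.stdAddChar m : ℂ).re) *
        (∑ n : ZMod L, (ZMod.stdAddChar (-(m * n)) : ℂ) * g n).re =
        -((2 * (ZMod.stdAddChar m : ℂ).re - 2) *
          (∑ n : ZMod L, (ZMod.stdAddChar (-(m * n)) : ℂ) * g n).re) := by ring
    rw [this, hre, hsplit]
    linarith
  have hlt := re_stdAddChar_lt_one hm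
  exact nonneg_of_mul_nonneg_right hprod (by linarith)

/-- **Discrete Pólya criterion, cosine-coefficient form**: if `Δ²g(n) ≥ 0` for `n ≠ 0` then
`0 ≤ Σ_n g(n) Re ψ(mn)` for every `m ≠ 0`. [cite: Polya1949, Thm. 1] -/
theorem sum_mul_re_stdAddChar_nonneg_of_cycleLaplacian_nonneg (g : ZMod L → ℝ)
    (hconv : ∀ n : ZMod L, n ≠ 0 → 0 ≤ cycleLaplacian g n) {m : ZMod L} (hm : m ≠ 0) :
    0 ≤ ∑ n : ZMod L, g n * (ZMod.stdAddChar (m * n) : ℂ).re := by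
  have h := re_sum_stdAddChar_mul_nonneg_of_cycleLaplacian_nonneg g hconv hm
  rw [Complex.re_sum] at h
  refine h.trans_eq (sum_congr rfl fun n _ => ?_)
  rw [stdAddChar_neg_eq_conj]
  simp only [Complex.mul_re, Complex.ofReal_re, Complex.ofReal_im, mul_zero, sub_zero,
    Complex.conj_re]
  ring

/-- **Discrete Pólya criterion in torus vocabulary** (`TorusSite 1 L = Fin 1 → ZMod L`, characters
`torusChar` of `TorusFourierProofs`): if the second differences of `f` along the cycle are
nonnegative away from the origin, then `0 ≤ Σ_v f(v) Re χ_q(v)` for every `q ≠ 0`. [cite: Polya1949, Thm. 1] -/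
theorem sum_mul_re_torusChar_nonneg_of_cycleLaplacian_nonneg (f : TorusSite 1 L → ℝ)
    (hconv : ∀ n : ZMod L, n ≠ 0 → 0 ≤ cycleLaplacian (fun n => f fun _ => n) n)
    {q : TorusSite 1 L} (hq : q ≠ 0) :
    0 ≤ ∑ v : TorusSite 1 L, f v * (torusChar q v).re := by
  have hq0 : q 0 ≠ 0 := fun h => hq (funext fun i => by rw [Subsingleton.elim i 0, h]; rfl)
  have h := sum_mul_re_stdAddChar_nonneg_of_cycleLaplacian_nonneg (fun n => f fun _ => n) hconv hq0
  rw [← (Equiv.funUnique (Fin 1) (ZMod L)).symm.sum_comp]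
  refine h.trans_eq (sum_congr rfl fun n _ => ?_)
  have hv : ((Equiv.funUnique (Fin 1) (ZMod L)).symm n : TorusSite 1 L) = fun _ => n := rfl
  rw [hv]
  simp [torusChar]

/-! ### Log-convexity away from the origin implies infinite divisibility -/

omit [NeZero L] in
/-- For a positive `k` on the cycle, the multiplicative inequality `k(n)² ≤ k(n−1) k(n+1)` is the
nonnegativity of the second difference of `log k` at `n`. [folklore] -/
theorem cycleLaplacian_log_nonneg_of_sq_le (k : ZMod L → ℝ) (hpos : ∀ n, 0 < k n) {n : ZMod L}
    (h : k n ^ 2 ≤ k (n - 1) * k (n + 1)) :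
    0 ≤ cycleLaplacian (fun n => Real.log (k n)) n := by
  have hlog := Real.log_le_log (pow_pos (hpos n) 2) h
  rw [Real.log_pow, Real.log_mul (hpos _).ne' (hpos _).ne'] at hlog
  simp only [cycleLaplacian]
  push_cast at hlog
  linarith

/-- **Log-convex away from the origin ⇒ `−log k` negative definite.** If `k > 0` on `ℤ/Lℤ` is even
and `k(n)² ≤ k(n−1) k(n+1)` for every `n ≠ 0`, then the translation-invariant kernel
`(x, y) ↦ −log k(x − y)` is negative definite (discrete Pólya for `log k`, then Bochner on the finite
torus). [cite: Horn1969, Thm. 1.6] -/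
theorem isNegDefKernel_negLog_of_logConvex_off_zero (k : ZMod L → ℝ) (hpos : ∀ n, 0 < k n)
    (heven : ∀ n, k (-n) = k n) (hconv : ∀ n : ZMod L, n ≠ 0 → k n ^ 2 ≤ k (n - 1) * k (n + 1)) :
    IsNegDefKernel fun x y : ZMod L => -Real.log (k (x - y)) := by
  refine isNegDefKernel_neg_of_factor_torus (d := 1) (L := L)
    (fun x y : ZMod L => Real.log (k (x - y))) (fun x _ => x) (fun v => Real.log (k (v 0)))
    (fun x y => rfl) (fun v => by simp only [Pi.neg_apply, heven]) fun q hq => ?_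
  refine sum_mul_re_torusChar_nonneg_of_cycleLaplacian_nonneg _ (fun n hn => ?_) hq
  exact cycleLaplacian_log_nonneg_of_sq_le k hpos (hconv n hn)

/-- **Log-convex away from the origin ⇒ infinitely divisible.** Under the same hypotheses every
Hadamard power `(x, y) ↦ k(x − y)^t`, `t ≥ 0`, is a positive definite kernel on `ℤ/Lℤ`
(Schoenberg: `exp(−tψ)` is positive definite for the negative definite `ψ = −log k(x − y)`).
[cite: BergChristensenRessel1984, Ch. 3 Thm. 2.2 (PDF p. 75)] -/
theorem isPosDefKernel_rpow_of_logConvex_off_zero (k : ZMod L → ℝ) (hpos : ∀ n, 0 < k n)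
    (heven : ∀ n, k (-n) = k n) (hconv : ∀ n : ZMod L, n ≠ 0 → k n ^ 2 ≤ k (n - 1) * k (n + 1))
    {t : ℝ} (ht : 0 ≤ t) : IsPosDefKernel fun x y : ZMod L => k (x - y) ^ t := by
  have h := ((isNegDefKernel_negLog_of_logConvex_off_zero k hpos heven hconv).const_mul
    ht).isPosDefKernel_exp_neg
  refine (funext fun x => funext fun y => ?_ : (fun x y : ZMod L =>
    Real.exp (-(t * -Real.log (k (x - y))))) = fun x y => k (x - y) ^ t) ▸ h
  rw [Real.rpow_def_of_pos (hpos _)]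
  congr 1
  ring

/-- **Matrix form**: under the same hypotheses the `ℤ/Lℤ × ℤ/Lℤ` matrix `(k(x − y)^t)_{x,y}` is
positive semidefinite for every `t ≥ 0` — all fractional Hadamard powers of the circulant `k(x − y)`
are positive semidefinite, i.e. the circulant is infinitely divisible. [cite: Horn1969, Cor. 1.7] -/
theorem posSemidef_rpow_of_logConvex_off_zero (k : ZMod L → ℝ) (hpos : ∀ n, 0 < k n)
    (heven : ∀ n, k (-n) = k n) (hconv : ∀ n : ZMod L, n ≠ 0 → k n ^ 2 ≤ k (n - 1) * k (n + 1))
    {t : ℝ} (ht : 0 ≤ t) : (Matrix.of fun x y : ZMod L => k (x - y) ^ t).PosSemidef := by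
  have h := (isPosDefKernel_rpow_of_logConvex_off_zero k hpos heven hconv ht).posSemidef_matrix
    (Fintype.equivFin (ZMod L)).symm
  have e : (Matrix.of fun j l : Fin (Fintype.card (ZMod L)) =>
      k ((Fintype.equivFin (ZMod L)).symm j - (Fintype.equivFin (ZMod L)).symm l) ^ t) =
      (Matrix.of fun x y : ZMod L => k (x - y) ^ t).submatrix
        (Fintype.equivFin (ZMod L)).symm (Fintype.equivFin (ZMod L)).symm := rfl
  rw [e, Matrix.posSemidef_submatrix_equiv] at h
  exact h

/-! ### Two coordinates: convexity of a partial cosine transform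

On the two-dimensional torus `(ℤ/Nℤ)²` the character factorises, `χ_q(a, b) = ψ(q₀ a) ψ(q₁ b)`. If
`f` is even in the second coordinate, the sine part of the inner sum vanishes and
`Σ_X f(X) Re χ_q(X) = Σ_a R(a) Re ψ(q₀ a)` with the PARTIAL COSINE TRANSFORM
`R(a) = Σ_b f(a, b) Re ψ(q₁ b)`; so if `R` is convex away from the origin of the cycle and `q₀ ≠ 0`,
the mode `q` of `f` is nonnegative by the one-dimensional criterion. (For the alternating mode
`q = (L/2, L/2)` of a function with the symmetries of the square, `R(a) = Σ_b (−1)^b f(a, b)` is the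
alternating column sum.) -/

section TwoDim

variable {N : ℕ} [NeZero N]

/-- The sine part of a partial transform of a function even in that coordinate vanishes:
`Σ_b f(a, b) Im ψ(m b) = 0` if `f(a, −b) = f(a, b)`. [folklore] -/
theorem sum_mul_im_stdAddChar_eq_zero_of_even (g : ZMod N → ℝ) (heven : ∀ b, g (-b) = g b)
    (m : ZMod N) : ∑ b : ZMod N, g b * (ZMod.stdAddChar (m * b) : ℂ).im = 0 := by
  have e := Equiv.sum_comp (Equiv.neg (ZMod N)) (fun b => g b * (ZMod.stdAddChar (m * b) : ℂ).im)
  have e' : ∑ b : ZMod N, g (-b) * (ZMod.stdAddChar (m * -b) : ℂ).im =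
      -∑ b : ZMod N, g b * (ZMod.stdAddChar (m * b) : ℂ).im := by
    rw [← sum_neg_distrib]
    refine sum_congr rfl fun b _ => ?_
    rw [heven, mul_neg, stdAddChar_neg_eq_conj, Complex.conj_im]
    ring
  simp only [Equiv.neg_apply] at e
  linarith

/-- **Two coordinates, convex partial cosine transform along the first.** For `f` on `(ℤ/Nℤ)²`
(`TorusSite 2 N`) even in the second coordinate and `q` with `q 0 ≠ 0`: if the partial cosine
transform `R(a) = Σ_b f(a, b) Re ψ(q₁ b)` has nonnegative second differences away from `a = 0`, then
`0 ≤ Σ_X f(X) Re χ_q(X)`. [cite: Polya1949, Thm. 1] -/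
theorem sum_mul_re_torusChar_nonneg_of_partial_convex_fst (f : TorusSite 2 N → ℝ)
    (q : TorusSite 2 N) (hq : q 0 ≠ 0) (heven : ∀ a b : ZMod N, f ![a, -b] = f ![a, b])
    (hconv : ∀ n : ZMod N, n ≠ 0 → 0 ≤ cycleLaplacian
      (fun a => ∑ b : ZMod N, f ![a, b] * (ZMod.stdAddChar (q 1 * b) : ℂ).re) n) :
    0 ≤ ∑ X : TorusSite 2 N, f X * (torusChar q X).re := by
  classical
  have h1 := sum_mul_re_stdAddChar_nonneg_of_cycleLaplacian_nonneg _ hconv hq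
  refine h1.trans_eq ?_
  symm
  rw [← (finTwoArrowEquiv (ZMod N)).symm.sum_comp, Fintype.sum_prod_type]
  refine sum_congr rfl fun a _ => ?_
  have hI := sum_mul_im_stdAddChar_eq_zero_of_even (fun b => f ![a, b]) (fun b => heven a b) (q 1)
  have hterm : ∀ b : ZMod N, f ((finTwoArrowEquiv (ZMod N)).symm (a, b)) *
      (torusChar q ((finTwoArrowEquiv (ZMod N)).symm (a, b))).re =
      (f ![a, b] * (ZMod.stdAddChar (q 1 * b) : ℂ).re) * (ZMod.stdAddChar (q 0 * a) : ℂ).re -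
        (f ![a, b] * (ZMod.stdAddChar (q 1 * b) : ℂ).im) * (ZMod.stdAddChar (q 0 * a) : ℂ).im := by
    intro b
    simp only [finTwoArrowEquiv_symm_apply, torusChar, Fin.prod_univ_two, Matrix.cons_val_zero,
      Matrix.cons_val_one, Complex.mul_re]
    ring
  simp_rw [hterm]
  rw [sum_sub_distrib, ← sum_mul, ← sum_mul, hI, zero_mul, sub_zero]

/-- **Two coordinates, convex partial cosine transform along the second** (the same with the roles
of the coordinates exchanged): for `f` even in the first coordinate and `q 1 ≠ 0`, convexity away from
the origin of `R(b) = Σ_a f(a, b) Re ψ(q₀ a)` gives `0 ≤ Σ_X f(X) Re χ_q(X)`. [cite: Polya1949, Thm. 1] -/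
theorem sum_mul_re_torusChar_nonneg_of_partial_convex_snd (f : TorusSite 2 N → ℝ)
    (q : TorusSite 2 N) (hq : q 1 ≠ 0) (heven : ∀ a b : ZMod N, f ![-a, b] = f ![a, b])
    (hconv : ∀ n : ZMod N, n ≠ 0 → 0 ≤ cycleLaplacian
      (fun b => ∑ a : ZMod N, f ![a, b] * (ZMod.stdAddChar (q 0 * a) : ℂ).re) n) :
    0 ≤ ∑ X : TorusSite 2 N, f X * (torusChar q X).re := by
  classical
  have h1 := sum_mul_re_stdAddChar_nonneg_of_cycleLaplacian_nonneg _ hconv hq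
  refine h1.trans_eq ?_
  symm
  rw [← (finTwoArrowEquiv (ZMod N)).symm.sum_comp, Fintype.sum_prod_type, sum_comm]
  refine sum_congr rfl fun b _ => ?_
  have hI := sum_mul_im_stdAddChar_eq_zero_of_even (fun a => f ![a, b]) (fun a => heven a b) (q 0)
  have hterm : ∀ a : ZMod N, f ((finTwoArrowEquiv (ZMod N)).symm (a, b)) *
      (torusChar q ((finTwoArrowEquiv (ZMod N)).symm (a, b))).re =
      (f ![a, b] * (ZMod.stdAddChar (q 0 * a) : ℂ).re) * (ZMod.stdAddChar (q 1 * b) : ℂ).re -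
        (f ![a, b] * (ZMod.stdAddChar (q 0 * a) : ℂ).im) * (ZMod.stdAddChar (q 1 * b) : ℂ).im := by
    intro a
    simp only [finTwoArrowEquiv_symm_apply, torusChar, Fin.prod_univ_two, Matrix.cons_val_zero,
      Matrix.cons_val_one, Complex.mul_re]
    ring
  simp_rw [hterm]
  rw [sum_sub_distrib, ← sum_mul, ← sum_mul, hI, zero_mul, sub_zero]

end TwoDim

end Literature.Probability.LatticeModels

end
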